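import Literature.Computability.MetaComplexity.NWEvalMachine
import Literature.Computability.MetaComplexity.KtDoubleRuler
import Literature.Computability.MetaComplexity.GapMINKTSearchProofs
import Literature.Computability.Complexity.SplitOnesBricks
import HarnessLib

/-!
# Hirahara's Lemma 4.10: outputs of the NW generator on `Enc(x)` are `K^t`-compressible (the program and its bound)

Topic `Literature/Computability/MetaComplexity`. The yes-side of the reduction of Thm. 4.21 / Cor. 4.23
(FOCS 2018 / ECCC TR18-138): Lemma 4.10, "`K_{t'}(NW^{Enc(x)}_{m,d}(z)) ≤ K_t(x) + d + O(log(nmd/δ))`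
for `t' ≥ t + poly`. Proof. … the following algorithm describes the output of the NW generator: Inputs
consist of parameters … represented in binary, a seed `z ∈ {0,1}^d`, and a string `d₀`. Compute
`x := U(d₀)`, `f := Enc(x)`, and the design. Output `NW^f_{m,d}(z)`." Here the algorithm is the `FP`
string function `NWOut.gY U enc` run under the DOUBLE ruler of `KtDoubleRuler.lean` (the time budget of
`U(d₀)` is the ruler, paid `O(log log t)` description bits — Lemma 4.19's device), on the design of lines
(`NWEvalMachine.lean`), for an arbitrary polynomial-time encoder `enc` (the list-decodable code of
Thm. 4.7 enters the reduction only through `enc ∈ FP` here):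

* `NWOut.hdrY`, `NWOut.payloadY` — the payload `⟨⟨bin e, bin ℓ, bin q, bin m, bin |d₀|⟩, d₀ ‖ z⟩` and its
  length (`length_payloadY_le`: `|d₀| + |z| + O(log)`);
* `NWOut.gY` — the program (ruler, numerals to unary, `U(d₀)` by `GapMINKTDecision.runU`, `enc`, `nwEvalF`),
  `gY_apply`, `gY_mem_FP`;
* **`NWOut.exists_ktAt_nwOut_le`** — Lemma 4.10 in the tree's model: for some `c₀` and polynomial `q₀`,
  whenever `U` prints `x` from `d₀` within `t ≤ T = 2^{2^{|u|}+|u|+1}` steps (and the numerals are `≤ T`),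
  `K^{q₀(2^{|expPad 1 u|} + |payload|)}(NW^{enc(1ᵉ,x)}(z)) ≤ |payload| + 2|u| + c₀`.

## References

* S. Hirahara, ECCC TR18-138 (2018), Lemma 4.10 and its proof (p. 18), Lemma 4.19, proof of Thm. 4.21.
* M. Li, P. Vitányi, *An Introduction to Kolmogorov Complexity and Its Applications*, §7.1.
-/

noncomputable section

namespace Literature.Computability.MetaComplexity

open _root_.Computability Polynomial Complexity Complexity.Brick Complexity.Plumb Complexity.OracleCompose Complexity.HashBricks

namespace NWOut

/-! ### The payload -/

/-- The header of binary numerals `⟨bin e, ⟨bin ℓ, ⟨bin q, ⟨bin m, bin |d₀|⟩⟩⟩⟩`. [cite: Hirahara2018, Lemma 4.10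
(proof: "parameters … represented in binary")] -/
def hdrY (e ℓ q m L : ℕ) : List Bool :=
  boolPair (encodeNat e) (boolPair (encodeNat ℓ) (boolPair (encodeNat q) (boolPair (encodeNat m) (encodeNat L))))

/-- **The payload** `⟨hdr, d₀ ‖ z⟩` (the description `d₀` of `x` and the seed `z`, raw).
[cite: Hirahara2018, Lemma 4.10 (proof)] -/
def payloadY (e ℓ q m : ℕ) (d₀ z : List Bool) : List Bool := boolPair (hdrY e ℓ q m d₀.length) (d₀ ++ z)

/-- Binary numerals of bounded numbers are short (twin of `DPKProg.length_encodeNat_le_of_le` in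
`DPReconstructionKProgram.lean`, not imported: unrelated heavy closure; librarian consolidation candidate). [folklore] -/
theorem length_encodeNat_le_of_le {v B : ℕ} (h : v ≤ B) : (encodeNat v).length ≤ Nat.log 2 B + 1 :=
  (TM2Pass.length_encodeNat_le v).trans (Nat.succ_le_succ (Nat.log_mono_right h))

/-- **Length of the payload**: `|d₀| + |z| + 18(log₂ B + 1) + 18` when the five numbers are `≤ B`.
[cite: Hirahara2018, Lemma 4.10 ("`|d₀| + |z| + O(log(nmd/δ))`")] -/
theorem length_payloadY_le {e ℓ q m B : ℕ} {d₀ z : List Bool} (he : e ≤ B) (hℓ : ℓ ≤ B) (hq : q ≤ B) (hm : m ≤ B) (hd : d₀.length ≤ B) :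
    (payloadY e ℓ q m d₀ z).length ≤ d₀.length + z.length + 18 * (Nat.log 2 B + 1) + 18 := by
  have := length_encodeNat_le_of_le he; have := length_encodeNat_le_of_le hℓ; have := length_encodeNat_le_of_le hq
  have := length_encodeNat_le_of_le hm; have := length_encodeNat_le_of_le hd
  simp only [payloadY, hdrY, length_boolPair, List.length_append]
  omega

/-! ### The program (on `w = ⟨R, payload⟩`, `R` with prefix `1^T`) -/

section Program

variable (U : UniversalMachine) (enc : List Bool → List Bool)

/-- The ruler `1^T`. [folklore] -/
def rulerF : List Bool → List Bool := onesPrefixFn ∘ fstF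
/-- The header. [folklore] -/
def hdrF : List Bool → List Bool := fstF ∘ sndF
/-- The body `d₀ ‖ z`. [folklore] -/
def bodyF : List Bool → List Bool := sndF ∘ sndF
/-- Unary expansion of numeral `i ≤ 3` of the header under the ruler. [folklore] -/
def numU (i : ℕ) : List Bool → List Bool := binToUnaryFn ∘ fanoutFn rulerF (nthF i ∘ hdrF)
/-- Unary expansion of the last numeral `|d₀|`. [folklore] -/
def num4U : List Bool → List Bool := binToUnaryFn ∘ fanoutFn rulerF (sndPow 3 ∘ hdrF)
/-- `d₀`. [folklore] -/
def d0F : List Bool → List Bool := takeFn ∘ fanoutFn num4U bodyF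
/-- `z`. [folklore] -/
def zF : List Bool → List Bool := dropFn ∘ fanoutFn num4U bodyF
/-- `x = U(d₀)` within the ruler's budget (the `Option` tag dropped). [cite: Hirahara2018, Lemma 4.10 (proof: "Compute `x := U(d₀)`")] -/
def xF : List Bool → List Bool := dropFn ∘ fanoutFn (fun _ => [true]) (GapMINKTDecision.runU U ∘ fanoutFn d0F rulerF)
/-- `f = enc(1ᵉ, x)`. [cite: Hirahara2018, Lemma 4.10 (proof: "`f := Enc(x)`")] -/
def fF : List Bool → List Bool := enc ∘ fanoutFn (numU 0) (xF U)
/-- **The program**: `NW^f(z)` on the design of lines with the decoded parameters.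
[cite: Hirahara2018, Lemma 4.10 (proof: "Output `NW^f_{m,d}(z)`")] -/
def gY : List Bool → List Bool :=
  NWLine.nwEvalF ∘ fanoutFn (fanoutFn (fF U enc) zF) (fanoutFn (numU 2) (fanoutFn (numU 1) (numU 3)))

end Program

/-! ### Values on a genuine payload under a long enough ruler -/

section Values

variable (U : UniversalMachine) (enc : List Bool → List Bool) (R' : List Bool) (T e ℓ q m : ℕ) (d₀ z : List Bool)

/-- The argument `⟨1^T 0 R', payload⟩`. [folklore] -/
def wOf : List Bool := boolPair (ones T ++ false :: R') (payloadY e ℓ q m d₀ z)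

/-- `rulerF` evaluated on its structured input. [folklore] -/
theorem rulerF_apply : rulerF (wOf R' T e ℓ q m d₀ z) = ones T := by
  simp only [rulerF, wOf, Function.comp_apply, fstF_boolPair]; exact onesPrefixFn_ones_append _ _
/-- `hdrF` evaluated on its structured input. [folklore] -/
theorem hdrF_apply : hdrF (wOf R' T e ℓ q m d₀ z) = hdrY e ℓ q m d₀.length := by
  simp [hdrF, wOf, payloadY]
/-- `bodyF` evaluated on its structured input. [folklore] -/
theorem bodyF_apply : bodyF (wOf R' T e ℓ q m d₀ z) = d₀ ++ z := by
  simp [bodyF, wOf, payloadY]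

/-- Unary expansion of a numeral `≤ T` under the ruler (twin of `DPKProg.binToUnary_ruler` in
`DPReconstructionKProgram.lean`, not imported: unrelated heavy closure; librarian consolidation candidate). [folklore] -/
theorem binToUnary_ruler {v T : ℕ} (hv : v ≤ T) : binToUnaryFn (boolPair (ones T) (encodeNat v)) = ones v := by
  rw [binToUnaryFn_boolPair, bitsToNat_encodeNat, List.length_replicate, min_eq_left hv]

variable {T e ℓ q m d₀}

/-- `numU` evaluated on its structured input. [folklore] -/
theorem numU_apply (he : e ≤ T) (hℓ : ℓ ≤ T) (hq : q ≤ T) (hm : m ≤ T) (hd : d₀.length ≤ T) :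
    numU 0 (wOf R' T e ℓ q m d₀ z) = ones e ∧ numU 1 (wOf R' T e ℓ q m d₀ z) = ones ℓ ∧ numU 2 (wOf R' T e ℓ q m d₀ z) = ones q ∧
    numU 3 (wOf R' T e ℓ q m d₀ z) = ones m ∧ num4U (wOf R' T e ℓ q m d₀ z) = ones d₀.length := by
  simp only [numU, num4U, Function.comp_apply, fanoutFn_apply, rulerF_apply, hdrF_apply, hdrY, nthF_zero_boolPair, nthF_succ_boolPair,
    sndPow_succ_boolPair, sndPow_zero, sndF_boolPair, binToUnary_ruler he, binToUnary_ruler hℓ, binToUnary_ruler hq, binToUnary_ruler hm,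
    binToUnary_ruler hd, nthF_zero, fstF_boolPair, and_self]

/-- `d0F` evaluated on its structured input. [folklore] -/
theorem d0F_apply (he : e ≤ T) (hℓ : ℓ ≤ T) (hq : q ≤ T) (hm : m ≤ T) (hd : d₀.length ≤ T) : d0F (wOf R' T e ℓ q m d₀ z) = d₀ := by
  simp only [d0F, Function.comp_apply, fanoutFn_apply, (numU_apply R' z he hℓ hq hm hd).2.2.2.2, bodyF_apply, takeFn_boolPair, ones,
    List.length_replicate, List.take_left']

/-- `zF` evaluated on its structured input. [folklore] -/
theorem zF_apply (he : e ≤ T) (hℓ : ℓ ≤ T) (hq : q ≤ T) (hm : m ≤ T) (hd : d₀.length ≤ T) : zF (wOf R' T e ℓ q m d₀ z) = z := by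
  simp only [zF, Function.comp_apply, fanoutFn_apply, (numU_apply R' z he hℓ hq hm hd).2.2.2.2, bodyF_apply, dropFn_boolPair, ones,
    List.length_replicate, List.drop_left']

/-- **`U(d₀)` under the ruler**: if `U` prints `x` from `d₀` within `T` steps, `xF` returns `x`.
[cite: Hirahara2018, Lemma 4.10 (proof)] -/
theorem xF_apply {x : List Bool} (hrun : U.run d₀ T = some x) (he : e ≤ T) (hℓ : ℓ ≤ T) (hq : q ≤ T) (hm : m ≤ T) (hd : d₀.length ≤ T) :
    xF U (wOf R' T e ℓ q m d₀ z) = x := by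
  rw [xF, Function.comp_apply, fanoutFn_apply, Function.comp_apply, fanoutFn_apply, d0F_apply R' z he hℓ hq hm hd, rulerF_apply,
    GapMINKTDecision.runU_boolPair, dropFn_boolPair]
  simp [ones, hrun]

/-- **The program on a genuine payload**: the NW output on `enc(1ᵉ, x)` and `z`.
[cite: Hirahara2018, Lemma 4.10 (proof)] -/
theorem gY_apply {x : List Bool} (hrun : U.run d₀ T = some x) (he : e ≤ T) (hℓ : ℓ ≤ T) (hq : q ≤ T) (hm : m ≤ T) (hd : d₀.length ≤ T) :
    gY U enc (wOf R' T e ℓ q m d₀ z) = NWStr.nwOut q (enc (boolPair (ones e) x)) (LineDesign.lineDesign q ℓ m) z := by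
  obtain ⟨h0, h1, h2, h3, -⟩ := numU_apply R' z he hℓ hq hm hd
  simp only [gY, fF, Function.comp_apply, fanoutFn_apply, h0, h1, h2, h3, xF_apply U R' z hrun he hℓ hq hm hd, zF_apply R' z he hℓ hq hm hd]
  exact NWLine.nwEvalF_apply _ _ _ _ _

end Values

/-! ### Polynomial time -/

/-- **`gY U enc ∈ FP`** for `enc ∈ FP`. [cite: Hirahara2018, Lemma 4.10 (proof: "the running time … is at most `t + poly`")] -/
theorem gY_mem_FP (U : UniversalMachine) {enc : List Bool → List Bool} (henc : enc ∈ FP) : gY U enc ∈ FP := by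
  have hruler : rulerF ∈ FP := comp_mem_FP onesPrefixFn_mem_FP fstF_mem_FP
  have hhdr : hdrF ∈ FP := comp_mem_FP fstF_mem_FP sndF_mem_FP
  have hbody : bodyF ∈ FP := comp_mem_FP sndF_mem_FP sndF_mem_FP
  have hnum : ∀ i, numU i ∈ FP := fun i => comp_mem_FP binToUnaryFn_mem_FP (fanoutFn_mem_FP hruler (comp_mem_FP (nthF_mem_FP i) hhdr))
  have hnum4 : num4U ∈ FP := comp_mem_FP binToUnaryFn_mem_FP (fanoutFn_mem_FP hruler (comp_mem_FP (sndPow_mem_FP 3) hhdr))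
  have hd0 : d0F ∈ FP := comp_mem_FP takeFn_mem_FP (fanoutFn_mem_FP hnum4 hbody)
  have hz : zF ∈ FP := comp_mem_FP dropFn_mem_FP (fanoutFn_mem_FP hnum4 hbody)
  have hx : xF U ∈ FP := comp_mem_FP dropFn_mem_FP (fanoutFn_mem_FP (const_mem_FP _)
    (comp_mem_FP (GapMINKTDecision.runU_mem_FP U) (fanoutFn_mem_FP hd0 hruler)))
  have hf : fF U enc ∈ FP := comp_mem_FP henc (fanoutFn_mem_FP (hnum 0) hx)
  exact comp_mem_FP NWLine.nwEvalF_mem_FP (fanoutFn_mem_FP (fanoutFn_mem_FP hf hz) (fanoutFn_mem_FP (hnum 2) (fanoutFn_mem_FP (hnum 1) (hnum 3))))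

/-! ### Lemma 4.10 in the tree's model -/

/-- The ruler length under the double pad with `|u| = J`: `T(u) = 2^{2^{|u|} + |u| + 1}`. [folklore] -/
def rulerLen (u : List Bool) : ℕ := 2 ^ (2 ^ u.length + u.length + 1)

/-- The double pad has ruler `1^{T(u)}`. [folklore] -/
theorem expPad_one_expPad_one_eq (u : List Bool) : expPad 1 (expPad 1 u) = ones (rulerLen u) ++ false :: expPad 1 u := by
  rw [expPad_one_expPad_one]; rfl

/-- **Hirahara 2018, Lemma 4.10 (tree form).** For every efficient universal machine `U` and every
polynomial-time encoder `enc` there are a constant `c₀` and a polynomial `q₀` such that: whenever `U`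
prints `x` from `d₀` within `t ≤ T(u)` steps and the parameters are `≤ T(u)`, the NW output
`NW^{enc(1ᵉ,x)}(z)` on the design of lines satisfies
`K^{q₀(2^{|expPad 1 u|} + |payload|)}(NW^{enc(1ᵉ,x)}(z)) ≤ |payload| + 2|u| + c₀`,
`payload = payloadY e ℓ q m d₀ z` (of length `|d₀| + |z| + O(log)`, `length_payloadY_le`) — i.e.
"`K_{t'}(NW^{Enc(x)}(z)) ≤ K_t(x) + d + O(log)`" with the budget `t` paid `2|u| = O(log log t)` bits.
[cite: Hirahara2018, Lemma 4.10] [cite: Hirahara2018, Lemma 4.19] -/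
theorem exists_ktAt_nwOut_le (U : UniversalMachine) {enc : List Bool → List Bool} (henc : enc ∈ FP) :
    ∃ (c₀ : ℕ) (q₀ : Polynomial ℕ), ∀ (u d₀ x z : List Bool) (e ℓ q m t : ℕ),
      U.run d₀ t = some x → t ≤ rulerLen u → e ≤ rulerLen u → ℓ ≤ rulerLen u → q ≤ rulerLen u → m ≤ rulerLen u →
      d₀.length ≤ rulerLen u →
      U.ktAt (q₀.eval (2 ^ (expPad 1 u).length + (payloadY e ℓ q m d₀ z).length))
          (NWStr.nwOut q (enc (boolPair (ones e) x)) (LineDesign.lineDesign q ℓ m) z) ≤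
        (payloadY e ℓ q m d₀ z).length + 2 * u.length + c₀ := by
  obtain ⟨c₀, q₀, h⟩ := U.exists_ktAt_le_of_FP₂ (gY_mem_FP U henc)
  refine ⟨c₀, q₀, fun u d₀ x z e ℓ q m t hrun ht he hℓ hq hm hd => ?_⟩
  have hrunT : U.run d₀ (rulerLen u) = some x := U.run_mono ht hrun
  have hg := h u (payloadY e ℓ q m d₀ z)
  rwa [expPad_one_expPad_one_eq, show boolPair (ones (rulerLen u) ++ false :: expPad 1 u) (payloadY e ℓ q m d₀ z) =
      wOf (expPad 1 u) (rulerLen u) e ℓ q m d₀ z from rfl, gY_apply U enc (expPad 1 u) z hrunT he hℓ hq hm hd] at hg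

end NWOut

end Literature.Computability.MetaComplexity

end
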